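import Mathlib
import Literature.Analysis.FluidPDE.ESSUniqueContinuationHolds

/-!
# Unique continuation from an open zero set for `‖Δv‖ ≤ C(‖v‖ + ‖Dv‖)` (stub `correctorKill_vecUCP`)

Support file for the refutation of crux `AdiabaticEddy.CorrectorSolvable`
(stmt-NavierStokesRegularity-1429, line `Sketch` = stokes-carleman-kill): the unique-continuation step.
A `C²` map `v : ℝ³ → ℝᵐ` with `‖Δv(y)‖ ≤ C_R (‖v(y)‖ + ‖Dv(y)‖)` on every ball `B(x₀, R)` which vanishes
on some ball `B(x₀, δ)` vanishes identically.

This is the time-independent case of the Escauriaza–Seregin–Šverák unique continuation theorem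
(ESS 2003, Thm. 4.1 = Seregin 2014, App. A.2, Thm. 2.4), PROVED in the tree as
`Literature.Analysis.FluidPDE.Carleman.uniqueContinuation_uncurried`: apply it to the space–time field
`U(t, x) := v(x + x₀)` on `]0, 1[ × B(0, R)`; `∂ₜU = 0`, the frame Laplacian is Mathlib's `Δ`
(`Carleman.lap_uncurry`), the operator norm of `Dv` is bounded by the frame gradient
(`Carleman.opNorm_fderiv_le_sqrt_gradSq`), and the origin is a zero of infinite order because
`v = 0` on `B(x₀, δ)` while `v` is bounded on the compact closed ball (`|U(z)| ≤ (M/δᵏ)(|z.2| + √z.1)ᵏ`).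

## References
* L. Escauriaza, G. Seregin, V. Šverák, Russ. Math. Surveys 58:2 (2003) 211–250, Thm. 4.1.
* G. Seregin, *Lecture notes on regularity theory for the Navier–Stokes equations* (2014), App. A.2.
-/

noncomputable section

-- the summit-side namespace `Summit.NavierStokesRegularity.NavierStokesRegularity.…` repeats a component by design (D-0017)
set_option linter.dupNamespace false

namespace Summit.NavierStokesRegularity.NavierStokesRegularity.Theorems

open Set Metric InnerProductSpace Function
open Literature.Analysis.FluidPDE

/-- The Laplacian commutes with translations: `Δ(f(· + a))(x) = Δf(x + a)` (vector-valued `f`).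
[folklore] -/
private theorem correctorKill_laplacian_comp_add_right {F : Type*} [NormedAddCommGroup F]
    [NormedSpace ℝ F] (f : EuclideanSpace ℝ (Fin 3) → F) (a x : EuclideanSpace ℝ (Fin 3)) :
    (Laplacian.laplacian fun z => f (z + a)) x = (Laplacian.laplacian f) (x + a) := by
  rw [laplacian_eq_iteratedFDeriv_stdOrthonormalBasis, laplacian_eq_iteratedFDeriv_stdOrthonormalBasis]
  simp only [iteratedFDeriv_comp_add_right]

/-- **Unique continuation from an open zero set, vector form** (stub `correctorKill_vecUCP` of the
`¬ CorrectorSolvable` skeleton). A `C²` map `v : ℝ³ → ℝᵐ` with `‖Δv‖ ≤ C_R (‖v‖ + ‖Dv‖)` on every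
ball `B(x₀, R)` and `v = 0` on some ball `B(x₀, δ)` vanishes identically: the time-independent case of
Escauriaza–Seregin–Šverák 2003, Thm. 4.1 (tree: `Carleman.uniqueContinuation_uncurried`), applied to
`U(t, x) := v(x + x₀)` on `]0,1[ × B(0, R)` with `R = dist(y, x₀) + 1` for each `y`.
[cite: EscauriazaSereginSverak2003, Thm. 4.1] -/
theorem correctorKill_vecUCP (m : ℕ) (v : EuclideanSpace ℝ (Fin 3) → EuclideanSpace ℝ (Fin m))
    (x₀ : EuclideanSpace ℝ (Fin 3)) (hv : ContDiff ℝ 2 v)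
    (hineq : ∀ R : ℝ, 0 < R → ∃ C : ℝ, ∀ y ∈ Metric.ball x₀ R,
      ‖Laplacian.laplacian v y‖ ≤ C * (‖v y‖ + ‖fderiv ℝ v y‖))
    (hvan : ∃ δ : ℝ, 0 < δ ∧ ∀ y ∈ Metric.ball x₀ δ, v y = 0) :
    v = 0 := by
  obtain ⟨δ, hδ, hzero⟩ := hvan
  funext y
  -- the radius and the constant of the differential inequality on `B(x₀, R)`
  set R : ℝ := dist y x₀ + 1 with hR
  have hR0 : 0 < R := by rw [hR]; positivity
  obtain ⟨C, hC⟩ := hineq R hR0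
  set c : ℝ := max C 0 with hc
  have hc0 : 0 ≤ c := le_max_right _ _
  -- the time-independent space–time field
  set u : ℝ → EuclideanSpace ℝ (Fin 3) → EuclideanSpace ℝ (Fin m) := fun _ x => v (x + x₀) with hu
  have huU : uncurry u = fun z => v (z.2 + x₀) := by
    funext z; rfl
  have hsmooth : ContDiff ℝ 2 (uncurry u) := by
    rw [huU]
    exact hv.comp (contDiff_snd.add contDiff_const)
  have hopen : IsOpen (Ioo (0 : ℝ) 1 ×ˢ ball (0 : EuclideanSpace ℝ (Fin 3)) R) :=
    isOpen_Ioo.prod isOpen_ball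
  have hC2 : ContDiffOn ℝ 2 (uncurry u) (Ioo (0 : ℝ) 1 ×ˢ ball (0 : EuclideanSpace ℝ (Fin 3)) R) :=
    hsmooth.contDiffOn
  have hcont : ContinuousOn (uncurry u) (Ico (0 : ℝ) 1 ×ˢ ball (0 : EuclideanSpace ℝ (Fin 3)) R) :=
    hsmooth.continuous.continuousOn
  -- translated points of `B(0, R)` lie in `B(x₀, R)`
  have hmem : ∀ x ∈ ball (0 : EuclideanSpace ℝ (Fin 3)) R, x + x₀ ∈ ball x₀ R := by
    intro x hx
    rw [mem_ball, dist_eq_norm, add_sub_cancel_right]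
    rwa [mem_ball, dist_zero_right] at hx
  -- the differential inequality in the frame calculus
  have hineq' : ∀ z ∈ Ioo (0 : ℝ) 1 ×ˢ ball (0 : EuclideanSpace ℝ (Fin 3)) R,
      ‖Carleman.dt (uncurry u) z + Carleman.lap (uncurry u) z‖ ≤
        c * (‖uncurry u z‖ + Real.sqrt (Carleman.gradSq (uncurry u) z)) := by
    rintro ⟨t, x⟩ hz
    have hd : DifferentiableAt ℝ (uncurry u) (t, x) :=
      (hsmooth.differentiable (by norm_num)).differentiableAt
    rw [Carleman.dt_uncurry hd, Carleman.lap_uncurry hopen hz hC2]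
    have h0 : Literature.Analysis.FluidPDE.timeDeriv u t x = 0 := by
      simp only [Literature.Analysis.FluidPDE.timeDeriv, hu, deriv_const]
    have hlap : Laplacian.laplacian (u t) x = Laplacian.laplacian v (x + x₀) := by
      have : u t = fun z => v (z + x₀) := rfl
      rw [this, correctorKill_laplacian_comp_add_right]
    have hfd : fderiv ℝ (u t) x = fderiv ℝ v (x + x₀) := by
      have : u t = fun z => v (z + x₀) := rfl
      rw [this, fderiv_comp_add_right]
    have h1 := hC (x + x₀) (hmem x hz.2)
    have h2 : ‖fderiv ℝ (u t) x‖ ≤ Real.sqrt (Carleman.gradSq (uncurry u) (t, x)) :=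
      Carleman.opNorm_fderiv_le_sqrt_gradSq hd
    have h3 : 0 ≤ ‖v (x + x₀)‖ + ‖fderiv ℝ v (x + x₀)‖ := by positivity
    rw [h0, zero_add, hlap]
    calc ‖Laplacian.laplacian v (x + x₀)‖ ≤ C * (‖v (x + x₀)‖ + ‖fderiv ℝ v (x + x₀)‖) := h1
      _ ≤ c * (‖v (x + x₀)‖ + ‖fderiv ℝ v (x + x₀)‖) :=
          mul_le_mul_of_nonneg_right (le_max_left _ _) h3
      _ ≤ c * (‖v (x + x₀)‖ + Real.sqrt (Carleman.gradSq (uncurry u) (t, x))) := by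
          rw [← hfd]; gcongr
      _ = c * (‖uncurry u (t, x)‖ + Real.sqrt (Carleman.gradSq (uncurry u) (t, x))) := rfl
  -- the origin is a zero of infinite order
  obtain ⟨M, hM⟩ : ∃ M : ℝ, ∀ x ∈ closedBall x₀ R, ‖v x‖ ≤ M :=
    (isCompact_closedBall x₀ R).exists_bound_of_continuousOn hv.continuous.continuousOn
  set M' : ℝ := max M 0 with hM'
  have hM'0 : 0 ≤ M' := le_max_right _ _
  have hvan' : ∀ k : ℕ, ∃ C' : ℝ, ∀ z ∈ Ioo (0 : ℝ) 1 ×ˢ ball (0 : EuclideanSpace ℝ (Fin 3)) R,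
      ‖uncurry u z‖ ≤ C' * (‖z.2‖ + Real.sqrt z.1) ^ k := by
    intro k
    refine ⟨M' / δ ^ k, ?_⟩
    rintro ⟨t, x⟩ hz
    have hb0 : 0 ≤ ‖x‖ + Real.sqrt t := by positivity
    by_cases hx : ‖x‖ < δ
    · have hxδ : x + x₀ ∈ ball x₀ δ := by
        rw [mem_ball, dist_eq_norm, add_sub_cancel_right]; exact hx
      have h0 : uncurry u (t, x) = 0 := hzero _ hxδ
      rw [h0, norm_zero]
      positivity
    · rw [not_lt] at hx
      have hxR : x + x₀ ∈ closedBall x₀ R := ball_subset_closedBall (hmem x hz.2)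
      have hratio : 1 ≤ ((‖x‖ + Real.sqrt t) / δ) ^ k :=
        one_le_pow₀ ((one_le_div hδ).2 (hx.trans (le_add_of_nonneg_right (Real.sqrt_nonneg _))))
      calc ‖uncurry u (t, x)‖ = ‖v (x + x₀)‖ := rfl
        _ ≤ M := hM _ hxR
        _ ≤ M' := le_max_left _ _
        _ ≤ M' * ((‖x‖ + Real.sqrt t) / δ) ^ k := le_mul_of_one_le_right hM'0 hratio
        _ = M' / δ ^ k * (‖x‖ + Real.sqrt t) ^ k := by rw [div_pow]; ring
  -- ESS unique continuation
  have hy : y - x₀ ∈ ball (0 : EuclideanSpace ℝ (Fin 3)) R := by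
    rw [mem_ball, dist_zero_right, ← dist_eq_norm, hR]; linarith
  have h := Carleman.uniqueContinuation_uncurried 3 m hc0 hR0 one_pos hC2 hcont hineq' hvan' (y - x₀) hy
  simpa [hu] using h

end Summit.NavierStokesRegularity.NavierStokesRegularity.Theorems

end
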